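import Summits.QuantumAdvantage.QuantumAdvantage.Theorems.LinnikCubicClassGroupsDegreeOnePrimesEscapeQuarticS4Count
import Summits.QuantumAdvantage.QuantumAdvantage.Theorems.LinnikCubicClassGroupsDegreeOnePrimesEscapeCubicSplittingPrimes
import HarnessLib

/-!
# Least primes in ONE-SIDED Frobenius classes: a Linnik-type bound from upper bounds only

Topic `Summits/QuantumAdvantage/QuantumAdvantage/Theorems`, cell B2b-1 (linnik-cubic), PART A (gen 8);
helper toward the crux `DegreeOnePrimesEscape` (stmt-QuantumAdvantage-11543) of route
`LinnikCubicClassGroups`.  HONEST FRAMING: the value of this file is a THEOREM (kernel-checked, GRH-free,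
Siegel-free, no hypothesis) — NOT summit progress.

**The one-sided principle** (`exists_frobenius_mem_of_oneSided`).  Fix `n > 1` and integers
`f₁ > s ≥ 0`, `t ≥ 0`.  There is `L = L(n, s, f₁, t) > 0` with the following property.  Let `N/ℚ` be a
Galois number field of degree `n` with group `G`, let `H₁, …, H_s < G` be proper subgroups (repetition
allowed) and `C ⊆ G` any subset such that POINTWISE on `G`

  `f₁ ≤ Σ_i Ind_{H_i}^G 1 (x) + t·𝟙[x ∈ C]`,   `Ind_H^G 1 (x) = #{g : g x g⁻¹ ∈ H} / |H|`.

Then some prime `p ≤ |d_N|^L`, `p ∤ d_N`, has a Frobenius in `C`: there are a prime `Q ∣ p` of `N` with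
trivial inertia and an arithmetic Frobenius `φ` at `Q` with `φ ∈ C`.  (The hypothesis says that the class
function `f₁ − Σ_i Ind_{H_i} 1` — of mean `f₁ − s > 0` — is `≤ t·𝟙_C`; e.g. `C` = 4-cycles in `S₄`
with `(H_i) = (A₄, A₄, D₈, S₃, S₃, S₃)`, `f₁ = 7`, `t = 6` (`…QuarticS4Group.lean`), or `C` = generators
of a cyclic `ℓ`-group with `H₁ = M` the maximal subgroup, `f₁ = t = ℓ` (`…CyclicInertPrime.lean`).)

Proof.  By Perlis' unramified dictionary, `Ind_{H_i} 1 (Frob_p) = a_{N^{H_i}}(p)`, the number of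
degree-one primes of the fixed field `N^{H_i}` above `p`; summing the pointwise inequality against
`log p` over `p ≤ x`:  `f₁ θ(x) − Σ_i θ¹_{N^{H_i}}(x) − c log|d_N| ≤ c Σ_{p ≤ x, p ∤ d_N, Frob_p ∈ C} log p`
(`c = max(f₁, t)`), and ONLY the prime number theorem `θ(x) ≥ (1−η)x` and the tree's UNIFORM UPPER
bounds `θ¹_E ≤ θ_E ≤ (1+η)x` for `x ≥ Q_E^{a([E:ℚ], η)}` (`chebyshevThetaIdeal_le_uniform`, degrees
`2 … n`) are needed, with `η (f₁ + s) ≤ 1/4`.  Exceptional zeros never enter.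

This is the mechanism behind Vinogradov's treatment of the least quadratic non-residue; compare the
"contradictory pairs" of P. J. Cho, R. J. Lemke Oliver, A. Zaman, arXiv:2512.24963 (2025), which need a
pole for `Ψ₊` and holomorphy for `Ψ₋` instead of pointwise domination.  A small LP shows the principle
applies to the 4-cycles of `S₄`, the 3-cycles of `A₄`, generators of cyclic `ℓ`-groups, the classes
`(4,1)`, `(3,2)` of `S₅`, the 5- and 3-cycles of `A₅`, but NOT to the 3-cycles of `S₃`, the rotations of
`D₄`, `D₅`, or the 5-cycles of `S₅` (LP optimum `0`).

References: J. C. Lagarias, H. L. Montgomery, A. M. Odlyzko, Invent. Math. 54 (1979)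
[LagariasMontgomeryOdlyzko1979]; R. Perlis, J. Number Theory 9 (1977) [Perlis1977]; J. Thorner,
A. Zaman, Algebra Number Theory 13 (2019) [ThornerZaman2019].
-/

noncomputable section

open scoped NumberField nonZeroDivisors
open Finset Real Ideal NumberField
open Literature.NumberTheory.NumberFields Literature.NumberTheory.LFunctions
  Literature.NumberTheory.LFunctions.NumberField

namespace Summit.QuantumAdvantage.QuantumAdvantage.Theorems.DegreeOnePrimesEscape

section OneSided

variable {N : Type} [Field N] [NumberField N] [IsGalois ℚ N]

/-- **The summed one-sided inequality.** Under the pointwise hypothesis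
`f₁ ≤ Σ_i c_{H_i}(x)/|H_i| + t·𝟙[x ∈ C]` on `Gal(N/ℚ)`, for every `x`:
`f₁ θ(x) − Σ_i θ¹_{N^{H_i}}(x) − max(f₁,t) log|d_N| ≤ max(f₁,t) · Σ_{p ≤ x, p ∤ d_N, Frob_p ∈ C} log p`. -/
theorem oneSided_sum_ge {s : ℕ} (H : Fin s → Subgroup (N ≃ₐ[ℚ] N)) (C : Set (N ≃ₐ[ℚ] N))
    [DecidablePred (· ∈ C)] (f₁ t : ℕ)
    (hpt : ∀ x : N ≃ₐ[ℚ] N, (f₁ : ℝ) ≤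
      ∑ i, (Nat.card {g : N ≃ₐ[ℚ] N // g * x * g⁻¹ ∈ H i} : ℝ) / Nat.card (H i) +
        (if x ∈ C then (t : ℝ) else 0))
    (P : ℕ → Prop) [DecidablePred P]
    (hP : ∀ p : ℕ, p.Prime → ∀ (Q : Ideal (𝓞 N)) [Q.IsMaximal] [Q.LiesOver (span {(p : ℤ)})]
      (φ : N ≃ₐ[ℚ] N), IsArithFrobAt ℤ φ Q → Q.inertia (N ≃ₐ[ℚ] N) = ⊥ → φ ∈ C → P p)
    (x : ℝ) :
    f₁ * Chebyshev.theta x - ∑ i, degreeOneTheta (IntermediateField.fixedField (H i)) x -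
        max (f₁ : ℝ) t * Real.log ((NumberField.discr N).natAbs : ℝ) ≤
      max (f₁ : ℝ) t * ∑ p ∈ (Nat.primesLE ⌊x⌋₊).filter
        (fun p : ℕ => ¬ ((p : ℤ) ∣ NumberField.discr N) ∧ P p), Real.log p := by
  classical
  set c : ℝ := max (f₁ : ℝ) t with hc
  have hc0 : 0 ≤ c := le_trans (Nat.cast_nonneg f₁) (le_max_left _ _)
  have h := sum_le_of_pointwise (N := N) c hc0
    (fun p => (f₁ : ℝ) - ∑ i, (((splittingType (IntermediateField.fixedField (H i)) p).count 1 : ℕ) : ℝ))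
    P ⌊x⌋₊ ?_ ?_
  · rw [Chebyshev.theta_eq_sum_primesLE]
    simp_rw [degreeOneTheta_eq_sum_count_one]
    refine le_trans (le_of_eq ?_) h
    rw [Finset.sum_comm, Finset.mul_sum, ← Finset.sum_sub_distrib]
    refine congrArg₂ _ (Finset.sum_congr rfl fun p _ => ?_) rfl
    rw [sub_mul, Finset.sum_mul]
  · intro p hp hd
    have hp' := (Nat.mem_primesLE.mp hp).2
    obtain ⟨Q₀, hQ₀max, hQ₀over, ⟨φ, hφ⟩, hI⟩ := exists_isArithFrobAt_of_not_dvd_discr (N := N) hp' hd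
    -- the dictionary: `a_{N^{H_i}}(p) = c_{H_i}(φ)/|H_i|`
    have ha : ∀ i, (((splittingType (IntermediateField.fixedField (H i)) p).count 1 : ℕ) : ℝ) =
        (Nat.card {g : N ≃ₐ[ℚ] N // g * φ * g⁻¹ ∈ H i} : ℝ) / Nat.card (H i) := by
      intro i
      have hk := card_fixingSubgroup_mul_count_one_splittingType
        (IntermediateField.fixedField (H i)) hp' Q₀ hφ hI
      rw [natCard_fixingSubgroup_fixedField] at hk
      simp only [IntermediateField.fixingSubgroup_fixedField] at hk
      have hH0 : (0 : ℝ) < Nat.card (H i) := by exact_mod_cast (Nat.card_pos (α := H i))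
      rw [eq_div_iff hH0.ne', mul_comm]
      exact_mod_cast hk
    have hx := hpt φ
    simp_rw [← ha] at hx
    by_cases hφC : φ ∈ C
    · rw [if_pos hφC] at hx
      rw [if_pos (hP p hp' Q₀ φ hφ hI hφC), mul_one]
      have : (t : ℝ) ≤ c := le_max_right _ _
      linarith
    · rw [if_neg hφC, add_zero] at hx
      have : 0 ≤ c * (if P p then 1 else 0) := by positivity
      linarith
  · intro p _ _
    have h0 : (0 : ℝ) ≤
        ∑ i, (((splittingType (IntermediateField.fixedField (H i)) p).count 1 : ℕ) : ℝ) :=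
      Finset.sum_nonneg fun i _ => Nat.cast_nonneg _
    have : (f₁ : ℝ) ≤ c := le_max_left _ _
    linarith

/-- `m^m ≤ d^{n²}` for `1 ≤ m ≤ n` and `d ≥ 3`. -/
private theorem pow_self_le_pow_sq' {m n : ℕ} (hm : m ≤ n) {d : ℝ} (hd : 3 ≤ d) :
    (m : ℝ) ^ m ≤ d ^ (n * n) := by
  have hn : (n : ℝ) ≤ d ^ n := by
    have h1 : (n : ℝ) < 2 ^ n := by exact_mod_cast Nat.lt_two_pow_self
    have h2 : (2 : ℝ) ^ n ≤ d ^ n := pow_le_pow_left₀ (by norm_num) (by linarith) n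
    linarith
  have hd1 : (1 : ℝ) ≤ d := by linarith
  calc (m : ℝ) ^ m ≤ (n : ℝ) ^ m := pow_le_pow_left₀ (Nat.cast_nonneg _) (by exact_mod_cast hm) m
    _ ≤ (d ^ n) ^ m := pow_le_pow_left₀ (Nat.cast_nonneg _) hn m
    _ = d ^ (n * m) := by rw [← pow_mul]
    _ ≤ d ^ (n * n) := pow_le_pow_right₀ hd1 (Nat.mul_le_mul_left n hm)

omit [IsGalois ℚ N] in
/-- A proper subgroup has a fixed field of degree `> 1`. -/
theorem one_lt_finrank_fixedField_of_ne_top (H : Subgroup (N ≃ₐ[ℚ] N)) (hH : H ≠ ⊤) :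
    1 < Module.finrank ℚ (IntermediateField.fixedField H) := by
  by_contra hle
  have h1 : Module.finrank ℚ (IntermediateField.fixedField H) = 1 :=
    le_antisymm (not_lt.mp hle) Module.finrank_pos
  rw [IntermediateField.finrank_eq_one_iff] at h1
  apply hH
  rw [← IntermediateField.fixingSubgroup_fixedField H, h1, IntermediateField.fixingSubgroup_bot]

set_option maxHeartbeats 800000 in
open scoped Classical in
/-- **Least primes in one-sided Frobenius classes.**  For `n > 1` and naturals `f₁ > s`, `t`, there is
`L > 0` such that: for every Galois number field `N` of degree `n`, every family `H₁, …, H_s` of proper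
subgroups of `G = Gal(N/ℚ)` and every `C ⊆ G` with `f₁ ≤ Σ_i Ind_{H_i} 1 (x) + t·𝟙[x ∈ C]` for all
`x ∈ G`, there is a prime `p ≤ |d_N|^L`, `p ∤ d_N`, with a prime `Q ∣ p` of `N` of trivial inertia and an
arithmetic Frobenius `φ ∈ C` at `Q`.  Unconditional; only upper bounds for the fixed fields `N^{H_i}` and
the prime number theorem for `ℚ` are used. [cite: LagariasMontgomeryOdlyzko1979, Theorem 1.1] -/
theorem exists_frobenius_mem_of_oneSided (n s f₁ t : ℕ) (hn : 1 < n) (hs : s < f₁) :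
    ∃ L : ℝ, 0 < L ∧ ∀ (N : Type) [Field N] [NumberField N] [IsGalois ℚ N],
      Module.finrank ℚ N = n →
      ∀ (H : Fin s → Subgroup (N ≃ₐ[ℚ] N)) (C : Set (N ≃ₐ[ℚ] N)), (∀ i, H i ≠ ⊤) →
        (∀ x : N ≃ₐ[ℚ] N, (f₁ : ℝ) ≤
          ∑ i, (Nat.card {g : N ≃ₐ[ℚ] N // g * x * g⁻¹ ∈ H i} : ℝ) / Nat.card (H i) +
            (if x ∈ C then (t : ℝ) else 0)) →
        ∃ p : ℕ, p.Prime ∧ (p : ℝ) ≤ ((NumberField.discr N).natAbs : ℝ) ^ L ∧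
          ¬ ((p : ℤ) ∣ NumberField.discr N) ∧
          ∃ (Q : Ideal (𝓞 N)) (_ : Q.IsMaximal) (_ : Q.LiesOver (span {(p : ℤ)})) (φ : N ≃ₐ[ℚ] N),
            IsArithFrobAt ℤ φ Q ∧ Q.inertia (N ≃ₐ[ℚ] N) = ⊥ ∧ φ ∈ C := by
  -- `η` with `η (f₁ + s) ≤ 1/4`
  set η : ℝ := 1 / (4 * ((f₁ : ℝ) + s) + 4) with hη
  have hfs0 : (0 : ℝ) ≤ (f₁ : ℝ) + s := by positivity
  have hη0 : 0 < η := by rw [hη]; positivity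
  have hηb : η * ((f₁ : ℝ) + s) ≤ 1 / 4 := by
    rw [hη, div_mul_eq_mul_div, one_mul, div_le_div_iff₀ (by positivity) (by norm_num)]
    nlinarith
  have hη1 : η ≤ 1 := by
    rw [hη, div_le_one (by positivity)]; linarith
  -- uniform upper bounds in every degree `2 ≤ m ≤ n`
  have hdeg : ∀ m : ℕ, ∃ a : ℝ, 1 ≤ a ∧ (1 < m → ∀ (K : Type) [Field K] [NumberField K],
      Module.finrank ℚ K = m → ∀ x : ℝ, ThornerZaman.condQn K ^ a ≤ x →
        chebyshevThetaIdeal K x ≤ (1 + η) * x) := by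
    intro m
    by_cases hm : 1 < m
    · obtain ⟨a, ha, h⟩ := chebyshevThetaIdeal_le_uniform m hm hη0
      exact ⟨a, ha, fun _ => h⟩
    · exact ⟨1, le_rfl, fun h => absurd h hm⟩
  choose a ha hupa using hdeg
  set A : ℝ := ∑ m ∈ Finset.range (n + 1), a m with hA
  have haA : ∀ m ≤ n, a m ≤ A := fun m hm =>
    Finset.single_le_sum (f := a) (fun i _ => le_trans zero_le_one (ha i))
      (Finset.mem_range.mpr (Nat.lt_succ_of_le hm))
  have hA1 : 1 ≤ A := le_trans (ha 0) (haA 0 (Nat.zero_le n))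
  obtain ⟨x₀, hx₀2, hθQ⟩ := chebyshevTheta_eventually_ge hη0
  set c : ℝ := max (f₁ : ℝ) t with hc
  have hc1 : (1 : ℝ) ≤ c := le_trans (by exact_mod_cast (show 1 ≤ f₁ by omega)) (le_max_left _ _)
  have hc0 : 0 < c := by linarith
  obtain ⟨L, hL, hthr⟩ :=
    exists_exponent_rpow (1 + (n : ℝ) * n) A x₀ (4 * c) (by positivity) (by linarith)
  refine ⟨L, hL, fun N _ _ _ hN H C hH hpt => ?_⟩
  -- sizes
  set d : ℝ := ((NumberField.discr N).natAbs : ℝ) with hd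
  have hd3 : (3 : ℝ) ≤ d := three_le_natAbs_discr_real N (by rw [hN]; exact hn)
  have hd0 : (0 : ℝ) < d := by linarith
  have hd1 : (1 : ℝ) ≤ d := by linarith
  obtain ⟨hx₀, hxQ, hxB⟩ := hthr d hd3
  set x : ℝ := d ^ L with hx
  have hx0 : 0 ≤ x := by positivity
  -- the fixed fields `E_i = N^{H_i}`: degree `2 ≤ m_i ≤ n`, conductor `≤ d^{1+n²}`, hence `θ¹_{E_i}(x) ≤ (1+η)x`
  have hE : ∀ i, degreeOneTheta (IntermediateField.fixedField (H i)) x ≤ (1 + η) * x := by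
    intro i
    have hgt := one_lt_finrank_fixedField_of_ne_top (H i) (hH i)
    have hle : Module.finrank ℚ (IntermediateField.fixedField (H i)) ≤ n := by
      have h2 := Module.finrank_mul_finrank ℚ (IntermediateField.fixedField (H i)) N
      rw [hN] at h2
      have hpos : 0 < Module.finrank (IntermediateField.fixedField (H i)) N := Module.finrank_pos
      exact le_of_le_of_eq (Nat.le_mul_of_pos_right _ hpos) h2
    have hdE : ((NumberField.discr (IntermediateField.fixedField (H i))).natAbs : ℝ) ≤ d := by
      have hdvd := NumberField.discr_dvd_discr (IntermediateField.fixedField (H i)) N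
      rw [hd]
      exact_mod_cast Nat.le_of_dvd (Int.natAbs_pos.mpr (NumberField.discr_ne_zero N))
        (Int.natAbs_dvd_natAbs.mpr hdvd)
    have hQ : ThornerZaman.condQn (IntermediateField.fixedField (H i)) ≤ d ^ ((1 : ℝ) + n * n) := by
      rw [ThornerZaman.condQn, ← Int.cast_abs, Int.abs_eq_natAbs, Int.cast_natCast,
        show (1 : ℝ) + n * n = (((1 + n * n : ℕ)) : ℝ) by push_cast; ring, Real.rpow_natCast,
        pow_add, pow_one]
      exact mul_le_mul hdE (pow_self_le_pow_sq' hle hd3) (by positivity) hd0.le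
    have hQ0 : 0 ≤ ThornerZaman.condQn (IntermediateField.fixedField (H i)) := by
      rw [ThornerZaman.condQn]; positivity
    have hdp : (1 : ℝ) ≤ d ^ ((1 : ℝ) + n * n) := Real.one_le_rpow hd1 (by positivity)
    have hQa : ThornerZaman.condQn (IntermediateField.fixedField (H i)) ^
        a (Module.finrank ℚ (IntermediateField.fixedField (H i))) ≤ x :=
      calc _ ≤ (d ^ ((1 : ℝ) + n * n)) ^ a (Module.finrank ℚ (IntermediateField.fixedField (H i))) :=
            Real.rpow_le_rpow hQ0 hQ (le_trans zero_le_one (ha _))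
        _ ≤ (d ^ ((1 : ℝ) + n * n)) ^ A := Real.rpow_le_rpow_of_exponent_le hdp (haA _ hle)
        _ ≤ x := hxQ
    exact (degreeOneTheta_le_chebyshevThetaIdeal _ x).trans
      (hupa _ hgt (IntermediateField.fixedField (H i)) rfl x hQa)
  have hsumE : ∑ i, degreeOneTheta (IntermediateField.fixedField (H i)) x ≤ s * ((1 + η) * x) := by
    have h := Finset.sum_le_card_nsmul (Finset.univ : Finset (Fin s))
      (fun i => degreeOneTheta (IntermediateField.fixedField (H i)) x) ((1 + η) * x) (fun i _ => hE i)
    rwa [Finset.card_univ, Fintype.card_fin, nsmul_eq_mul] at h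
  -- the analytic inputs
  have hθ : (1 - η) * x ≤ Chebyshev.theta x := hθQ x hx₀
  have hlog : c * Real.log d ≤ x / 4 := by
    have hlogd : Real.log d ≤ d := (Real.log_le_sub_one_of_pos hd0).trans (by linarith)
    have := mul_le_mul_of_nonneg_left hlogd hc0.le
    linarith
  -- the one-sided sum
  have hsum := oneSided_sum_ge H C f₁ t hpt
    (fun p => ∃ (Q : Ideal (𝓞 N)) (_ : Q.IsMaximal) (_ : Q.LiesOver (span {(p : ℤ)}))
      (φ : N ≃ₐ[ℚ] N), IsArithFrobAt ℤ φ Q ∧ Q.inertia (N ≃ₐ[ℚ] N) = ⊥ ∧ φ ∈ C)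
    (fun p _ Q _ _ φ hφ hI hC => ⟨Q, ‹_›, ‹_›, φ, hφ, hI, hC⟩) x
  have hf₁θ : (f₁ : ℝ) * ((1 - η) * x) ≤ f₁ * Chebyshev.theta x :=
    mul_le_mul_of_nonneg_left hθ (Nat.cast_nonneg _)
  have h1 : (1 : ℝ) ≤ (f₁ : ℝ) - s := by
    have : s + 1 ≤ f₁ := hs
    have : ((s : ℝ) + 1) ≤ f₁ := by exact_mod_cast this
    linarith
  have hcoef : (3 / 4 : ℝ) ≤ ((f₁ : ℝ) - s) - η * ((f₁ : ℝ) + s) := by linarith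
  have hmain : 3 / 4 * x ≤ (f₁ : ℝ) * ((1 - η) * x) - s * ((1 + η) * x) := by
    have := mul_le_mul_of_nonneg_right hcoef hx0
    have e : (((f₁ : ℝ) - s) - η * ((f₁ : ℝ) + s)) * x =
        (f₁ : ℝ) * ((1 - η) * x) - s * ((1 + η) * x) := by ring
    linarith
  have hpos : 0 < ∑ p ∈ (Nat.primesLE ⌊x⌋₊).filter
      (fun p : ℕ => ¬ ((p : ℤ) ∣ NumberField.discr N) ∧
        ∃ (Q : Ideal (𝓞 N)) (_ : Q.IsMaximal) (_ : Q.LiesOver (span {(p : ℤ)})) (φ : N ≃ₐ[ℚ] N),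
          IsArithFrobAt ℤ φ Q ∧ Q.inertia (N ≃ₐ[ℚ] N) = ⊥ ∧ φ ∈ C), Real.log p := by
    have hcS : 0 < c * ∑ p ∈ (Nat.primesLE ⌊x⌋₊).filter
        (fun p : ℕ => ¬ ((p : ℤ) ∣ NumberField.discr N) ∧
          ∃ (Q : Ideal (𝓞 N)) (_ : Q.IsMaximal) (_ : Q.LiesOver (span {(p : ℤ)})) (φ : N ≃ₐ[ℚ] N),
            IsArithFrobAt ℤ φ Q ∧ Q.inertia (N ≃ₐ[ℚ] N) = ⊥ ∧ φ ∈ C), Real.log p := by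
      have hx1 : 0 < x := by positivity
      rw [hd] at hlog
      linarith
    exact pos_of_mul_pos_right hcS hc0.le
  obtain ⟨p, hp, hpx, hpN, hP⟩ := exists_prime_of_sum_log_pos hpos
  exact ⟨p, hp, hpx, hpN, hP⟩

end OneSided

end Summit.QuantumAdvantage.QuantumAdvantage.Theorems.DegreeOnePrimesEscape

end
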